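import Summits.QuantumFields.YangMills.Theorems.SwapVirialDeficitSectorLaplaceDefs
import HarnessLib

/-!
# THE `y₀`-DEPENDENT ROTATION OF THE TRANSVERSE `x`-PLANE: a measure-preserving, density-preserving measurable equivalence of the gnomonic coordinates
# (sector-001 base ∕ fibre plumbing of LEAD sfw-p2 g98's memo7 plan of record for ⟨stmt-QuantumFields-24197⟩ `SwapVirialDeficit.SwapGluedStiffness`, §E(5) ∕ board 19:28Z:
# "FIBRE = (δ, x ⊥ ω(φ) (2, a y′₀-dependent rotation of the x-plane: measurable-equiv plumbing), y′⊥ (2), z (3), η_F)")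

In the translated chart of sector `001` the flat set has `x = t·ω(φ)` with `ω(φ) ∝ (0, 1, −y′₀)` in the `x`-letter's coordinates (`y′₀ = −tan φ`): the BASE direction of the
`x`-letter turns with the `y`-letter's axial coordinate.  Rotating the transverse `x`-plane `(x₁, x₂)` by the angle `arctan y′₀` straightens it (`rotX_arctan_flatDir`:
`(0, 1, −y₀) ↦ (0, √(1+y₀²), 0)`), after which base = `(y′₀, x′₁)` and fibre ∋ `x′₀, x′₂` are COORDINATE slots, as the fibred Laplace lemma wants.  Everything is done for an
ARBITRARY measurable angle function `θ : ℝ → ℝ` of `y₀`: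
* §1 `rotX θ v = (v₀, cos θ·v₁ − sin θ·v₂, sin θ·v₁ + cos θ·v₂)`: group law, inverse, `Σ(rotX θ v)ₖ² = Σvₖ²`, ✓`gnomonicWeight` invariant, continuity, the matrix form and
  `det = 1`, ★ `measurePreserving_rotX` (Lebesgue measure on `ℝ³`), `rotX_arctan_flatDir`;
* §2 `xSkewRot θ η := ((rotX (θ (η.1.2 0)) η.1.1, η.1.2), η.2)` on `GnoCoord L`: inverse `xSkewRot (−θ)`, measurability, ★ `measurePreserving_xSkewRot` (skew product over the
  `y`-letter), `gnoDensity_xSkewRot` (the density is invariant), the measurable equivalence `xSkewRotEquiv θ hθ`;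
* §3 ★★ `map_xSkewRot_fibreMeasure` (`ρ(η)dη` is invariant), ★★ `measurePreserving_hub_xSkewRot_chartMeasure` (`id × xSkewRot θ` preserves `chartMeasure L = cone ⊗ ρdη`),
  ★★ `measurePreserving_delta_xSkewRot_muB` (`id × xSkewRot θ` preserves `μ_B = ((1+δ²)⁻¹)²ρ(η) dδ dη` on `ℝ × GnoCoord L`, the measure of ✓`lintegral_chartMeasure_hubCot`).
HONEST LABEL: measure-theoretic plumbing (two definitions); which angle function and which region the 001 analysis uses is the width seats' call; nothing about ⟨24197⟩,
⟨24194⟩ or any rung is proved here; the Yang–Mills mass gap is NOT proved; no summit is proved by a line.  Seat ym-line-fcl-p3 g47 (cell ym-idea-1, free hands ➎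
assembler; item of record ⟨24085⟩ aside, untouched), `--supports stmt-QuantumFields-24197`.  Two `def`s + one `MeasurableEquiv`, theorems otherwise; no instance, no
notation; 0 `sorry`; standard axioms.  References: [cite: Luscher1983, §2]; [folklore].
-/

set_option autoImplicit false
set_option synthInstance.maxSize 1024

noncomputable section

open MeasureTheory Set
open scoped Quaternion BigOperators ENNReal
open Summit.QuantumFields.YangMills.Theorems.SwapTwistDeficit.ToronLog

attribute [local instance] Literature.Analysis.FluidPDE.Tao2016.quatMeasurableSpace
  Literature.Analysis.FluidPDE.Tao2016.quatBorelSpace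

namespace Summit.QuantumFields.YangMills.Theorems.SwapVirialDeficit.BlowUpRing

open Summit.QuantumFields.YangMills.Theorems.FemtoTransferGap
open Summit.QuantumFields.YangMills.Theorems.SwapVirialDeficit.Gnomonic (gnomonicWeight normSq3 piWeight gnomonicWeight_pos)
open Summit.QuantumFields.YangMills.Theorems.SwapVirialDeficit.SectorLaplace (fibreMeasure chartMeasure)

variable {L : ℕ} [NeZero L]

/-! ## §1 The rotation of the transverse plane of one letter -/

/-- **Rotation of the transverse plane** of a letter's gnomonic coordinates by the angle `θ`: the axial coordinate `v₀` is fixed, `(v₁, v₂)` turns. [folklore] -/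
def rotX (θ : ℝ) (v : Fin 3 → ℝ) : Fin 3 → ℝ :=
  ![v 0, Real.cos θ * v 1 - Real.sin θ * v 2, Real.sin θ * v 1 + Real.cos θ * v 2]

/-- Components of `rotX`. [folklore] -/
theorem rotX_apply (θ : ℝ) (v : Fin 3 → ℝ) :
    rotX θ v 0 = v 0 ∧ rotX θ v 1 = Real.cos θ * v 1 - Real.sin θ * v 2 ∧ rotX θ v 2 = Real.sin θ * v 1 + Real.cos θ * v 2 :=
  ⟨rfl, rfl, rfl⟩

/-- `rotX 0 = id`. [folklore] -/
@[simp] theorem rotX_zero (v : Fin 3 → ℝ) : rotX 0 v = v := by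
  ext i; fin_cases i <;> simp [rotX]

/-- The group law `rotX (θ₁ + θ₂) = rotX θ₁ ∘ rotX θ₂`. [folklore] -/
theorem rotX_add (θ₁ θ₂ : ℝ) (v : Fin 3 → ℝ) : rotX (θ₁ + θ₂) v = rotX θ₁ (rotX θ₂ v) := by
  ext i
  fin_cases i
  · simp [rotX]
  · simp [rotX, Real.cos_add, Real.sin_add]; ring
  · simp [rotX, Real.cos_add, Real.sin_add]; ring

/-- `rotX (−θ)` undoes `rotX θ`. [folklore] -/
@[simp] theorem rotX_neg_rotX (θ : ℝ) (v : Fin 3 → ℝ) : rotX (-θ) (rotX θ v) = v := by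
  rw [← rotX_add, neg_add_cancel, rotX_zero]

/-- `rotX θ` undoes `rotX (−θ)`. [folklore] -/
@[simp] theorem rotX_rotX_neg (θ : ℝ) (v : Fin 3 → ℝ) : rotX θ (rotX (-θ) v) = v := by
  rw [← rotX_add, add_neg_cancel, rotX_zero]

/-- ★ The rotation preserves the squared length `Σ vₖ²`. [folklore] -/
theorem sum_sq_rotX (θ : ℝ) (v : Fin 3 → ℝ) : ∑ k, rotX θ v k ^ 2 = ∑ k, v k ^ 2 := by
  simp only [Fin.sum_univ_three, rotX, Matrix.cons_val_zero, Matrix.cons_val_one, Matrix.cons_val]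
  nlinarith [Real.sin_sq_add_cos_sq θ]

/-- `normSq3` is invariant. [folklore] -/
theorem normSq3_rotX (θ : ℝ) (v : Fin 3 → ℝ) : normSq3 (rotX θ v) = normSq3 v := by
  unfold normSq3; exact sum_sq_rotX θ v

/-- ★ The gnomonic weight `(1 + |v|²)⁻²` is invariant under the rotation. [folklore] -/
theorem gnomonicWeight_rotX (θ : ℝ) (v : Fin 3 → ℝ) : gnomonicWeight (rotX θ v) = gnomonicWeight v := by
  unfold gnomonicWeight; rw [normSq3_rotX]

/-- `(θ, v) ↦ rotX θ v` is continuous. [folklore] -/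
theorem continuous_rotX_uncurry : Continuous fun p : ℝ × (Fin 3 → ℝ) => rotX p.1 p.2 := by
  refine continuous_pi fun i => ?_
  have h0 : Continuous fun p : ℝ × (Fin 3 → ℝ) => p.2 0 := (continuous_apply 0).comp continuous_snd
  have h1 : Continuous fun p : ℝ × (Fin 3 → ℝ) => p.2 1 := (continuous_apply 1).comp continuous_snd
  have h2 : Continuous fun p : ℝ × (Fin 3 → ℝ) => p.2 2 := (continuous_apply 2).comp continuous_snd
  have hc : Continuous fun p : ℝ × (Fin 3 → ℝ) => Real.cos p.1 := Real.continuous_cos.comp continuous_fst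
  have hs : Continuous fun p : ℝ × (Fin 3 → ℝ) => Real.sin p.1 := Real.continuous_sin.comp continuous_fst
  fin_cases i
  · exact h0
  · exact (hc.mul h1).sub (hs.mul h2)
  · exact (hs.mul h1).add (hc.mul h2)

/-- `rotX θ` is continuous. [folklore] -/
theorem continuous_rotX (θ : ℝ) : Continuous (rotX θ) := continuous_rotX_uncurry.comp (continuous_const.prodMk continuous_id)

/-- `rotX θ` is measurable. [folklore] -/
theorem measurable_rotX (θ : ℝ) : Measurable (rotX θ) := (continuous_rotX θ).measurable

/-- The matrix of the rotation. [folklore] -/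
theorem rotX_eq_mulVec (θ : ℝ) (v : Fin 3 → ℝ) :
    rotX θ v = Matrix.mulVec !![1, 0, 0; 0, Real.cos θ, -Real.sin θ; 0, Real.sin θ, Real.cos θ] v := by
  ext i
  fin_cases i
  · simp [rotX, Matrix.mulVec, dotProduct, Fin.sum_univ_three]
  · simp [rotX, Matrix.mulVec, dotProduct, Fin.sum_univ_three]; ring
  · simp [rotX, Matrix.mulVec, dotProduct, Fin.sum_univ_three]

/-- Its determinant is `cos² + sin² = 1`. [folklore] -/
theorem det_rotXMatrix (θ : ℝ) : Matrix.det !![1, 0, 0; 0, Real.cos θ, -Real.sin θ; 0, Real.sin θ, Real.cos θ] = 1 := by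
  rw [Matrix.det_fin_three]
  simp
  nlinarith [Real.sin_sq_add_cos_sq θ]

/-- `rotX θ` is the linear map of its matrix. [folklore] -/
theorem rotX_eq_toLin' (θ : ℝ) : rotX θ = ⇑(Matrix.toLin' !![1, 0, 0; 0, Real.cos θ, -Real.sin θ; 0, Real.sin θ, Real.cos θ]) := by
  funext v; rw [Matrix.toLin'_apply, rotX_eq_mulVec]

/-- ★ **The rotation preserves Lebesgue measure on `ℝ³`** (`|det| = 1`). [folklore] -/
theorem measurePreserving_rotX (θ : ℝ) : MeasurePreserving (rotX θ) (volume : Measure (Fin 3 → ℝ)) volume := by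
  refine ⟨measurable_rotX θ, ?_⟩
  have hdet : LinearMap.det (Matrix.toLin' !![1, 0, 0; 0, Real.cos θ, -Real.sin θ; 0, Real.sin θ, Real.cos θ]) ≠ 0 := by
    rw [LinearMap.det_toLin', det_rotXMatrix]; exact one_ne_zero
  rw [rotX_eq_toLin', Measure.map_linearMap_addHaar_eq_smul_addHaar volume hdet, LinearMap.det_toLin', det_rotXMatrix, inv_one, abs_one,
    ENNReal.ofReal_one, one_smul]

/-- ★ **Straightening the 001 flat direction**: the rotation by `arctan y₀` maps the direction `(0, 1, −y₀)` of the flat set to `(0, √(1+y₀²), 0)`. [folklore] -/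
theorem rotX_arctan_flatDir (y₀ t : ℝ) : rotX (Real.arctan y₀) ![0, t, -(t * y₀)] = ![0, t * Real.sqrt (1 + y₀ ^ 2), 0] := by
  have hc : Real.cos (Real.arctan y₀) = 1 / Real.sqrt (1 + y₀ ^ 2) := Real.cos_arctan y₀
  have hs : Real.sin (Real.arctan y₀) = y₀ / Real.sqrt (1 + y₀ ^ 2) := Real.sin_arctan y₀
  have hq : 0 < Real.sqrt (1 + y₀ ^ 2) := Real.sqrt_pos.2 (by positivity)
  have hq2 : Real.sqrt (1 + y₀ ^ 2) ^ 2 = 1 + y₀ ^ 2 := Real.sq_sqrt (by positivity)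
  ext i
  fin_cases i
  · simp [rotX]
  · simp [rotX, hc, hs]
    field_simp
    rw [hq2]
  · simp [rotX, hc, hs]
    field_simp
    ring

/-! ## §2 The skew rotation of the `x`-letter by an angle depending on the `y`-letter's axial coordinate -/

/-- **THE SKEW ROTATION** of the gnomonic coordinates: the transverse plane of the `x`-letter is rotated by `θ(y₀)`, `y₀ = η.1.2 0` the axial coordinate of the `y`-letter;
all other coordinates are fixed. [folklore] -/
def xSkewRot (θ : ℝ → ℝ) (η : GnoCoord L) : GnoCoord L := ((rotX (θ (η.1.2 0)) η.1.1, η.1.2), η.2)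

omit [NeZero L] in
/-- Unfolding `xSkewRot`. [folklore] -/
theorem xSkewRot_apply (θ : ℝ → ℝ) (η : GnoCoord L) : xSkewRot θ η = ((rotX (θ (η.1.2 0)) η.1.1, η.1.2), η.2) := rfl

omit [NeZero L] in
/-- The `y`-letter, the `z`-letter and the followers are untouched. [folklore] -/
theorem xSkewRot_snd (θ : ℝ → ℝ) (η : GnoCoord L) : (xSkewRot θ η).1.2 = η.1.2 ∧ (xSkewRot θ η).2 = η.2 := ⟨rfl, rfl⟩

omit [NeZero L] in
/-- `xSkewRot (−θ)` undoes `xSkewRot θ`. [folklore] -/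
@[simp] theorem xSkewRot_neg_xSkewRot (θ : ℝ → ℝ) (η : GnoCoord L) : xSkewRot (fun t => -θ t) (xSkewRot θ η) = η := by
  simp only [xSkewRot, rotX_neg_rotX, Prod.mk.eta]

omit [NeZero L] in
/-- `xSkewRot θ` undoes `xSkewRot (−θ)`. [folklore] -/
@[simp] theorem xSkewRot_xSkewRot_neg (θ : ℝ → ℝ) (η : GnoCoord L) : xSkewRot θ (xSkewRot (fun t => -θ t) η) = η := by
  simp only [xSkewRot, rotX_rotX_neg, Prod.mk.eta]

omit [NeZero L] in
/-- `xSkewRot θ` is measurable for a measurable angle function. [folklore] -/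
theorem measurable_xSkewRot {θ : ℝ → ℝ} (hθ : Measurable θ) : Measurable (xSkewRot (L := L) θ) := by
  have hang : Measurable fun η : GnoCoord L => θ (η.1.2 0) := hθ.comp ((measurable_pi_apply 0).comp (measurable_snd.comp measurable_fst))
  have hx : Measurable fun η : GnoCoord L => rotX (θ (η.1.2 0)) η.1.1 :=
    continuous_rotX_uncurry.measurable.comp (hang.prodMk (measurable_fst.comp measurable_fst))
  exact (hx.prodMk (measurable_snd.comp measurable_fst)).prodMk measurable_snd

/-- ★ The density `gnoDensity` is invariant under the skew rotation (`ρ_x` depends on `|x|²` only). [folklore] -/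
theorem gnoDensity_xSkewRot (θ : ℝ → ℝ) (η : GnoCoord L) : gnoDensity (xSkewRot θ η) = gnoDensity η := by
  simp only [gnoDensity, xSkewRot, gnomonicWeight_rotX]

/-- The skew rotation of the pair `(x, y)` preserves Lebesgue measure on `ℝ³ × ℝ³` (skew product over `y`, ✓`measurePreserving_rotX` fibrewise). [folklore] -/
theorem measurePreserving_xySkewRot {θ : ℝ → ℝ} (hθ : Measurable θ) :
    MeasurePreserving (fun p : (Fin 3 → ℝ) × (Fin 3 → ℝ) => (rotX (θ (p.2 0)) p.1, p.2))
      ((volume : Measure (Fin 3 → ℝ)).prod (volume : Measure (Fin 3 → ℝ))) ((volume : Measure (Fin 3 → ℝ)).prod (volume : Measure (Fin 3 → ℝ))) := by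
  have hgm : Measurable (Function.uncurry fun (y : Fin 3 → ℝ) (x : Fin 3 → ℝ) => rotX (θ (y 0)) x) :=
    continuous_rotX_uncurry.measurable.comp ((hθ.comp ((measurable_pi_apply 0).comp measurable_fst)).prodMk measurable_snd)
  have hg : ∀ᵐ y : Fin 3 → ℝ ∂(volume : Measure (Fin 3 → ℝ)),
      Measure.map ((fun (y : Fin 3 → ℝ) (x : Fin 3 → ℝ) => rotX (θ (y 0)) x) y) (volume : Measure (Fin 3 → ℝ)) = volume :=
    Filter.Eventually.of_forall fun y => (measurePreserving_rotX (θ (y 0))).map_eq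
  have hskew := (MeasurePreserving.id (volume : Measure (Fin 3 → ℝ))).skew_product hgm hg
  -- conjugate by the swap
  have hswap : MeasurePreserving (Prod.swap : (Fin 3 → ℝ) × (Fin 3 → ℝ) → (Fin 3 → ℝ) × (Fin 3 → ℝ))
      ((volume : Measure (Fin 3 → ℝ)).prod (volume : Measure (Fin 3 → ℝ))) ((volume : Measure (Fin 3 → ℝ)).prod (volume : Measure (Fin 3 → ℝ))) :=
    Measure.measurePreserving_swap
  have h := hswap.comp (hskew.comp hswap)
  exact h

/-- ★ **THE SKEW ROTATION PRESERVES LEBESGUE MEASURE** on `GnoCoord L`. [folklore] -/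
theorem measurePreserving_xSkewRot {θ : ℝ → ℝ} (hθ : Measurable θ) : MeasurePreserving (xSkewRot (L := L) θ) volume volume := by
  have h := (measurePreserving_xySkewRot hθ).prod
    (MeasurePreserving.id ((volume : Measure (Fin 3 → ℝ)).prod (Measure.pi fun _ : Fol L => (volume : Measure (Fin 3 → ℝ)))))
  have e : xSkewRot (L := L) θ = Prod.map (fun p : (Fin 3 → ℝ) × (Fin 3 → ℝ) => (rotX (θ (p.2 0)) p.1, p.2)) id := funext fun η => rfl
  rw [e, show (volume : Measure (GnoCoord L)) = ((volume : Measure (Fin 3 → ℝ)).prod (volume : Measure (Fin 3 → ℝ))).prod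
    ((volume : Measure (Fin 3 → ℝ)).prod (Measure.pi fun _ : Fol L => (volume : Measure (Fin 3 → ℝ)))) from rfl]
  exact h

/-- ★ **THE SKEW ROTATION AS A MEASURABLE EQUIVALENCE** of `GnoCoord L` (inverse: the skew rotation by `−θ`). [folklore] -/
def xSkewRotEquiv (θ : ℝ → ℝ) (hθ : Measurable θ) : GnoCoord L ≃ᵐ GnoCoord L where
  toFun := xSkewRot θ
  invFun := xSkewRot fun t => -θ t
  left_inv := fun η => xSkewRot_neg_xSkewRot θ η
  right_inv := fun η => xSkewRot_xSkewRot_neg θ η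
  measurable_toFun := by exact measurable_xSkewRot hθ
  measurable_invFun := by exact measurable_xSkewRot (θ := fun t => -θ t) hθ.neg

omit [NeZero L] in
/-- `xSkewRotEquiv θ hθ` is `xSkewRot θ`. [folklore] -/
theorem xSkewRotEquiv_apply {θ : ℝ → ℝ} (hθ : Measurable θ) (η : GnoCoord L) : xSkewRotEquiv θ hθ η = xSkewRot θ η := rfl

omit [NeZero L] in
/-- Its inverse is `xSkewRot (−θ)`. [folklore] -/
theorem xSkewRotEquiv_symm_apply {θ : ℝ → ℝ} (hθ : Measurable θ) (η : GnoCoord L) :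
    (xSkewRotEquiv θ hθ).symm η = xSkewRot (fun t => -θ t) η := rfl

/-! ## §3 Invariance of the fibre measure, the chart measure and `μ_B` -/

/-- ★★ **`ρ(η)dη` IS INVARIANT**: `(fibreMeasure L).map (xSkewRot θ) = fibreMeasure L`. [folklore] -/
theorem map_xSkewRot_fibreMeasure {θ : ℝ → ℝ} (hθ : Measurable θ) : (fibreMeasure L).map (xSkewRot θ) = fibreMeasure L := by
  set e : GnoCoord L ≃ᵐ GnoCoord L := xSkewRotEquiv θ hθ with he
  have hvol : MeasurePreserving e (volume : Measure (GnoCoord L)) volume := measurePreserving_xSkewRot hθ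
  have hρ : Measurable fun η : GnoCoord L => ENNReal.ofReal (gnoDensity η) := ENNReal.measurable_ofReal.comp measurable_gnoDensity
  rw [show xSkewRot (L := L) θ = ⇑e from rfl]
  ext s hs
  rw [e.map_apply, SectorLaplace.fibreMeasure, withDensity_apply _ hs, withDensity_apply _ (e.measurable hs)]
  have h1 : ∫⁻ η in e ⁻¹' s, ENNReal.ofReal (gnoDensity η) ∂(volume : Measure (GnoCoord L)) =
      ∫⁻ η in e ⁻¹' s, ENNReal.ofReal (gnoDensity (e η)) ∂(volume : Measure (GnoCoord L)) := by
    refine setLIntegral_congr_fun (e.measurable hs) (fun η _ => ?_)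
    rw [show e η = xSkewRot θ η from rfl, gnoDensity_xSkewRot]
  rw [h1, ← setLIntegral_map hs hρ e.measurable, hvol.map_eq]

/-- ★★ **`id × xSkewRot θ` PRESERVES THE ➎ CHART MEASURE** `chartMeasure L = cone ⊗ ρ(η)dη`. [folklore] -/
theorem measurePreserving_hub_xSkewRot_chartMeasure {θ : ℝ → ℝ} (hθ : Measurable θ) :
    MeasurePreserving (Prod.map id (xSkewRot θ) : ℍ × GnoCoord L → ℍ × GnoCoord L) (chartMeasure L) (chartMeasure L) := by
  haveI := isProbabilityMeasure_coneMeasure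
  haveI : SFinite (fibreMeasure L) := by unfold SectorLaplace.fibreMeasure; infer_instance
  have hf : MeasurePreserving (xSkewRot (L := L) θ) (fibreMeasure L) (fibreMeasure L) := ⟨measurable_xSkewRot hθ, map_xSkewRot_fibreMeasure hθ⟩
  unfold SectorLaplace.chartMeasure
  exact (MeasurePreserving.id coneMeasure).prod hf

/-- ★★ **`id × xSkewRot θ` PRESERVES `μ_B = ((1+δ²)⁻¹)²ρ(η) dδ dη`** on `ℝ × GnoCoord L` (the measure of the ➎ regions in the hub letter, ✓`lintegral_chartMeasure_hubCot`).
[folklore] -/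
theorem measurePreserving_delta_xSkewRot_muB {θ : ℝ → ℝ} (hθ : Measurable θ) :
    MeasurePreserving (Prod.map id (xSkewRot θ) : ℝ × GnoCoord L → ℝ × GnoCoord L)
      ((volume : Measure (ℝ × GnoCoord L)).withDensity fun p => ENNReal.ofReal (((1 + p.1 ^ 2)⁻¹) ^ 2 * gnoDensity p.2))
      ((volume : Measure (ℝ × GnoCoord L)).withDensity fun p => ENNReal.ofReal (((1 + p.1 ^ 2)⁻¹) ^ 2 * gnoDensity p.2)) := by
  set e : ℝ × GnoCoord L ≃ᵐ ℝ × GnoCoord L := (MeasurableEquiv.refl ℝ).prodCongr (xSkewRotEquiv θ hθ) with he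
  have hee : (Prod.map id (xSkewRot θ) : ℝ × GnoCoord L → ℝ × GnoCoord L) = ⇑e := rfl
  have hvol : MeasurePreserving e (volume : Measure (ℝ × GnoCoord L)) volume := by
    rw [← hee, show (volume : Measure (ℝ × GnoCoord L)) = (volume : Measure ℝ).prod (volume : Measure (GnoCoord L)) from rfl]
    exact (MeasurePreserving.id (volume : Measure ℝ)).prod (measurePreserving_xSkewRot hθ)
  have hJ : Measurable fun p : ℝ × GnoCoord L => ENNReal.ofReal (((1 + p.1 ^ 2)⁻¹) ^ 2 * gnoDensity p.2) :=
    ENNReal.measurable_ofReal.comp ((((measurable_const.add (measurable_fst.pow_const 2)).inv).pow_const 2).mul (measurable_gnoDensity.comp measurable_snd))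
  have hJinv : ∀ p : ℝ × GnoCoord L, ((1 + (e p).1 ^ 2)⁻¹) ^ 2 * gnoDensity (e p).2 = ((1 + p.1 ^ 2)⁻¹) ^ 2 * gnoDensity p.2 := fun p => by
    show ((1 + p.1 ^ 2)⁻¹) ^ 2 * gnoDensity (xSkewRot θ p.2) = _
    rw [gnoDensity_xSkewRot]
  rw [hee]
  refine ⟨e.measurable, ?_⟩
  ext s hs
  rw [e.map_apply, withDensity_apply _ hs, withDensity_apply _ (e.measurable hs)]
  have h1 : ∫⁻ p in e ⁻¹' s, ENNReal.ofReal (((1 + p.1 ^ 2)⁻¹) ^ 2 * gnoDensity p.2) ∂(volume : Measure (ℝ × GnoCoord L)) =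
      ∫⁻ p in e ⁻¹' s, ENNReal.ofReal (((1 + (e p).1 ^ 2)⁻¹) ^ 2 * gnoDensity (e p).2) ∂(volume : Measure (ℝ × GnoCoord L)) :=
    setLIntegral_congr_fun (e.measurable hs) (fun p _ => by rw [hJinv])
  rw [h1, ← setLIntegral_map hs hJ e.measurable, hvol.map_eq]

end Summit.QuantumFields.YangMills.Theorems.SwapVirialDeficit.BlowUpRing

end
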